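import Literature.Geometry.Lorentzian.CoordBoundaryCoercivityIntegrals
import HarnessLib

/-!
# The interior Gårding inequality for the KID operator (Chruściel–Delay 2003, Prop. 3.1 / (2.14))

Topic `Literature/Geometry/Lorentzian`, coordinate tensor calculus `MetricCoord` (Riemannian metric
components `G` on an open set `V` of dimension `≠ 1`, a smooth field `K` of symmetric forms).
Everything here is PROVED; no definition and no statement of `Prop` type is introduced.

Companion of `CoordBoundaryCoercivity.lean` ((3.4) near the boundary): on compactly supported
fields the first derivatives of `Y` and the first and second derivatives of `N` are controlled by
the rows `R_K = adjHamK N + adjMomKS Y`, `R_G = adjHamG N + adjMomGS Y` of the KID operator `P*`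
together with the `L²` norms of `(Y, N)` — the Gårding-type inequality behind Prop. 3.1 of
Chruściel–Delay (Mém. SMF 94 (2003); there obtained from the Green identity (2.14)), in the
unweighted form appropriate to a compact region (where the weights `φ, ψ` are bounded above and
below):

* `IsMetricOn.integral_gradSq_le_half` — `∫ √g|∇N|² ≤ ½∫ √g N² + ½∫ √g (ΔN)²`
  (`div(N∇N) = |∇N|² + NΔN`);
* **`IsMetricOn.interiorGarding`** — if `Ric(v,v) ≤ ρ|v|²`, `|(tr K)G + 2K|² ≤ w₁`, `|Z|² ≤ z₁`,
  `|K|² ≤ k₁`, `|∇K|² ≤ k₂` on `V`, then for all `N, Y` smooth on `V` with compact support in `V`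
  `∫ √g (|∇Y|² + |Hess N|² + |∇N|²) ≤ C (∫ √g |R_K|² + ∫ √g |R_G|² + ∫ √g N² + ∫ √g |Y|²)`
  with `C` explicit in `n, ρ, w₁, z₁, k₁, k₂`.

## References

* P. T. Chruściel, E. Delay, Mém. Soc. Math. Fr. 94 (2003), §2 (2.14), §3 Prop. 3.1.
  [ChruscielDelay2003]
-/

noncomputable section

set_option maxSynthPendingDepth 3

open Set Filter Module Function MeasureTheory
open scoped Topology ContDiff

namespace Literature.Geometry.Lorentzian

namespace MetricCoord

variable {E : Type*} [NormedAddCommGroup E] [NormedSpace ℝ E] [FiniteDimensional ℝ E]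
  [CompleteSpace E] {ι : Type*} [Fintype ι] [DecidableEq ι] (b : Basis ι ℝ E)
  {G : E → E →L[ℝ] E →L[ℝ] ℝ} {V : Set E} {K : E → E →L[ℝ] E →L[ℝ] ℝ} {N : E → ℝ} {Y : E → E}
  [MeasurableSpace E] [BorelSpace E] (μ : Measure E) [μ.IsAddHaarMeasure]

/-! ### Interpolation: `∫|∇N|² ≤ ½∫N² + ½∫(ΔN)²` -/

/-- **`∫ √g|∇N|² ≤ ½ ∫ √g N² + ½ ∫ √g (ΔN)²`** for `N` smooth on `V` with compact support inside
`V` (`div(N∇N) = |∇N|² + NΔN`, the divergence theorem, `−NΔN ≤ ½N² + ½(ΔN)²`). [folklore] -/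
theorem IsMetricOn.integral_gradSq_le_half (hG : IsMetricOn G V)
    (hpos : ∀ y ∈ V, ∀ e : E, e ≠ 0 → 0 < G y e e)
    (hN : ContDiffOn ℝ ∞ N V) (hNs : HasCompactSupport N) (hNV : tsupport N ⊆ V) :
    ∫ y, sqrtDetGram G b y * gradSqAt G N y ∂μ ≤
      2⁻¹ * ∫ y, sqrtDetGram G b y * N y ^ 2 ∂μ + 2⁻¹ * ∫ y, sqrtDetGram G b y * lapAt G N y ^ 2 ∂μ := by
  -- the field `B = N ∇N`
  set B : E → E := fun y ↦ N y • sharpAt G y (fderiv ℝ N y) with hBdef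
  have hN0 : ∀ y ∉ tsupport N, N y = 0 ∧ fderiv ℝ N y = 0 := fun y hy ↦
    (eventually_eq_zero_and_fderiv_eq_zero hy).self_of_nhds
  have hZs : ContDiffOn ℝ ∞ (fun y ↦ sharpAt G y (fderiv ℝ N y)) V :=
    hG.contDiffOn_sharpAt.clm_apply (hN.fderiv_of_isOpen hG.isOpen (by simp))
  have hBs : ContDiffOn ℝ ∞ B V := hN.smul hZs
  have hB0 : ∀ y ∉ tsupport N, B y = 0 := fun y hy ↦ by simp [hBdef, (hN0 y hy).1]
  have hBt : tsupport B ⊆ tsupport N :=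
    closure_minimal (fun y hy ↦ by by_contra h; exact hy (hB0 y h)) (isClosed_tsupport N)
  have hBsupp : HasCompactSupport B := hNs.mono' ((subset_tsupport _).trans hBt)
  have hBV : tsupport B ⊆ V := hBt.trans hNV
  have hdiv0 : ∫ y, sqrtDetGram G b y * divAt G B y ∂μ = 0 :=
    hG.integral_sqrtDetGram_mul_divAt_eq_zero b μ hpos hBs hBsupp hBV
  -- `div B = |∇N|² + N ΔN` on `V`
  have hdiv : ∀ y ∈ V, divAt G B y = gradSqAt G N y + N y * lapAt G N y := by
    intro y hy
    have hys := hG.mem_nhds hy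
    have hNd : DifferentiableAt ℝ N y := ((hN y hy).contDiffAt hys).differentiableAt (by simp)
    have hZd : DifferentiableAt ℝ (fun z ↦ sharpAt G z (fderiv ℝ N z)) y :=
      ((hZs y hy).contDiffAt hys).differentiableAt (by simp)
    rw [hBdef, divAt_smul hNd hZd, hG.divAt_sharpAt_fderiv hy hN, gradSqAt_apply]
    ring
  -- integrability
  have hdivB0 : ∀ y ∉ tsupport N, divAt G B y = 0 := fun y hy ↦
    divAt_eq_zero_of_eventuallyEq_zero (notMem_tsupport_iff_eventuallyEq.mp fun h ↦ hy (hBt h))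
  have hlap0 : ∀ y ∉ tsupport N, lapAt G N y = 0 := fun y hy ↦ by
    rw [lapAt_congr_of_eventuallyEq G (notMem_tsupport_iff_eventuallyEq.mp hy)]
    exact lapAt_const G 0
  have hg0 : ∀ y ∉ tsupport N, gradSqAt G N y = 0 := fun y hy ↦ by
    rw [gradSqAt_apply, (hN0 y hy).2]; rfl
  have hInt : ∀ {k : E → ℝ}, ContDiffOn ℝ ∞ k V → (∀ z ∉ tsupport N, k z = 0) →
      Integrable (fun z ↦ sqrtDetGram G b z * k z) μ := fun hk hk0 ↦
    hG.integrable_sqrtDetGram_mul_of_subset b μ hpos hNs (isClosed_tsupport N) hNV hk hk0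
  have hI₁ := hInt (hG.contDiffOn_gradSqAt hN) hg0
  have hI₂ := hInt (hN.pow 2) fun z hz ↦ by simp [(hN0 z hz).1]
  have hI₃ := hInt ((hG.contDiffOn_lapAt hN).pow 2) fun z hz ↦ by simp [hlap0 z hz]
  have hId := hInt (hG.contDiffOn_divAt hBs) hdivB0
  -- `|∇N|² = div B − NΔN ≤ div B + ½N² + ½(ΔN)²`
  have h := integral_sqrtDetGram_le_of_pointwise₃ b μ (tsupport N) 2⁻¹ 2⁻¹ 1 hI₁ hI₂ hI₃ hId
    (fun y hy ↦ ?_) (fun y hy ↦ ⟨hg0 y hy, by simp [(hN0 y hy).1], by simp [hlap0 y hy], hdivB0 y hy⟩)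
  · rw [hdiv0, mul_zero, add_zero] at h
    exact h
  · rw [hdiv y (hNV hy)]
    nlinarith [sq_nonneg (N y + lapAt G N y)]

/-! ### The Gårding inequality -/

set_option maxHeartbeats 1600000 in
/-- **The interior Gårding inequality for the KID operator** (Chruściel–Delay 2003, Prop. 3.1,
unweighted compact-support form). Let `G` be Riemannian metric components on `V` (`dim ≠ 1`) and
`K` a smooth field of symmetric forms with, on `V`, `Ric(v,v) ≤ ρ|v|²`, `|(tr K)G + 2K|² ≤ w₁`,
`|Z|² ≤ z₁` (`Z` as in `kidRowG_recovery`), `|K|² ≤ k₁`, `|∇K|² ≤ k₂`. Then there is `C`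
(explicit in `n, ρ, w₁, z₁, k₁, k₂`) such that for all `N, Y` smooth on `V` with compact support
inside `V`,
`∫ √g|∇Y|² + ∫ √g|Hess N|² + ∫ √g|∇N|² ≤ C (∫ √g|R_K|² + ∫ √g|R_G|² + ∫ √g N² + ∫ √g|Y|²)`
(`|∇Y|² = tr_G G(∇Y,∇Y)`, `R_K = adjHamK N + adjMomKS Y`, `R_G = adjHamG N + adjMomGS Y`): the
`H¹ × H²` norm of `(Y, N)` is controlled by `P*(Y,N)` and the `L²` norm.
[cite: ChruscielDelay2003, Prop. 3.1, (2.14)] -/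
theorem IsMetricOn.interiorGarding (hG : IsMetricOn G V)
    (hpos : ∀ y ∈ V, ∀ e : E, e ≠ 0 → 0 < G y e e) (hn : finrank ℝ E ≠ 1)
    (hK : ContDiffOn ℝ ∞ K V) (hKs : ∀ y ∈ V, ∀ v w, K y v w = K y w v)
    {ρ w₁ z₁ k₁ k₂ : ℝ} (hρ : 0 ≤ ρ) (hw₁ : 0 ≤ w₁) (hz₁ : 0 ≤ z₁) (hk₁ : 0 ≤ k₁) (hk₂ : 0 ≤ k₂)
    (hric : ∀ y ∈ V, ∀ v : E, ricAt G y v v ≤ ρ * G y v v)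
    (hWK : ∀ y ∈ V, normSqAt G y (mtrAt G y (K y) • G y + (2 : ℝ) • K y) ≤ w₁)
    (hZ : ∀ y ∈ V, normSqAt G y (ricAt G y - (2 : ℝ) • (K y).comp ((sharpAt G y).comp (K y))
        + (2 * mtrAt G y (K y)) • K y
        + (((finrank ℝ E : ℝ) - 1)⁻¹ * (-scalAt G y
            + 2 * mtrAt G y ((K y).comp ((sharpAt G y).comp (K y)))
            - 2 * mtrAt G y (K y) ^ 2)) • G y) ≤ z₁)
    (hKn : ∀ y ∈ V, normSqAt G y (K y) ≤ k₁)
    (hcovK : ∀ y ∈ V,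
      ∑ k, ∑ l, ginv G b y k l * pairAt G y (cov₂At G K y (b k)) (cov₂At G K y (b l)) ≤ k₂) :
    ∃ C : ℝ, ∀ (N : E → ℝ) (Y : E → E), ContDiffOn ℝ ∞ N V → ContDiffOn ℝ ∞ Y V →
      HasCompactSupport N → HasCompactSupport Y → tsupport N ⊆ V → tsupport Y ⊆ V →
      ∫ y, sqrtDetGram G b y * mtrAt G y ((G y).bilinearComp (covDAt G Y y) (covDAt G Y y)) ∂μ
        + ∫ y, sqrtDetGram G b y * normSqAt G y (hessAt G N y) ∂μ
        + ∫ y, sqrtDetGram G b y * gradSqAt G N y ∂μ ≤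
      C * (∫ y, sqrtDetGram G b y * normSqAt G y (adjHamK G K N y + adjMomKS G Y y) ∂μ
        + ∫ y, sqrtDetGram G b y * normSqAt G y (adjHamG G K N y + adjMomGS G K Y y) ∂μ
        + ∫ y, sqrtDetGram G b y * N y ^ 2 ∂μ
        + ∫ y, sqrtDetGram G b y * G y (Y y) (Y y) ∂μ) := by
  -- constants
  set n : ℝ := (finrank ℝ E : ℝ) with hndef
  set cn : ℝ := 3 + 3 * (3 / (2 * (n - 1))) ^ 2 * n ^ 2 with hcn
  set an : ℝ := 6 * (1 + ((n - 1)⁻¹) ^ 2 * n ^ 2) with han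
  set sn : ℝ := 2 + n ^ 2 / 2 with hsn
  set c1 : ℝ := 4 + 3 * n with hc1
  set c2 : ℝ := 1 + 2 * n ^ 2 with hc2
  have hn0 : 0 ≤ n := Nat.cast_nonneg _
  have hcn0 : 0 ≤ cn := by positivity
  have han0 : 0 ≤ an := by positivity
  have hsn0 : 0 ≤ sn := by positivity
  have hc10 : 0 ≤ c1 := by positivity
  have hc20 : 0 ≤ c2 := by positivity
  set CQ : ℝ := 4 * sn * cn + 12 * sn * w₁ + 2 * ρ with hCQ
  have hCQ0 : 0 ≤ CQ := by positivity
  set CH : ℝ := an + 3 * z₁ + an * c1 * k₁ * CQ + an * c2 * k₂ with hCH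
  have hCH0 : 0 ≤ CH := by positivity
  refine ⟨CQ + (1 + n / 2) * CH + 2⁻¹, fun N Y hN hY hNs hYs hNV hYV ↦ ?_⟩
  -- the support
  set S : Set E := tsupport N ∪ tsupport Y with hSdef
  have hS : IsCompact S := hNs.union hYs
  have hSc : IsClosed S := (isClosed_tsupport N).union (isClosed_tsupport Y)
  have hSV : S ⊆ V := union_subset hNV hYV
  -- smoothness on `V`
  have hA : ContDiffOn ℝ ∞ (covDAt G Y) V := hG.contDiffOn_covDAt hY
  have hQs : ContDiffOn ℝ ∞ (fun y ↦ mtrAt G y ((G y).bilinearComp (covDAt G Y y) (covDAt G Y y))) V := by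
    have heq : (fun y ↦ mtrAt G y ((G y).bilinearComp (covDAt G Y y) (covDAt G Y y))) =
        fun y ↦ ∑ i, ∑ j, ginv G b y i j * G y (covDAt G Y y (b i)) (covDAt G Y y (b j)) := by
      funext y
      rw [mtrAt_eq_sum b]
      simp only [ContinuousLinearMap.bilinearComp_apply]
    rw [heq]
    refine ContDiffOn.sum fun i _ ↦ ContDiffOn.sum fun j _ ↦ ?_
    exact (hG.contDiffOn_ginv b i j).mul
      ((hG.contDiffOn.clm_apply (hA.clm_apply contDiffOn_const)).clm_apply
        (hA.clm_apply contDiffOn_const))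
  have hHs : ContDiffOn ℝ ∞ (fun y ↦ normSqAt G y (hessAt G N y)) V :=
    hG.contDiffOn_normSqAt (hG.contDiffOn_hessAt hN)
  have hRKs : ContDiffOn ℝ ∞ (fun y ↦ normSqAt G y (adjHamK G K N y + adjMomKS G Y y)) V :=
    hG.contDiffOn_normSqAt ((hG.contDiffOn_adjHamK hK hN).add (hG.contDiffOn_adjMomKS hY))
  have hRGs : ContDiffOn ℝ ∞ (fun y ↦ normSqAt G y (adjHamG G K N y + adjMomGS G K Y y)) V :=
    hG.contDiffOn_normSqAt ((hG.contDiffOn_adjHamG hK hN).add (hG.contDiffOn_adjMomGS hK hY))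
  have hMs : ContDiffOn ℝ ∞ (fun y ↦ normSqAt G y (adjMomGS G K Y y)) V :=
    hG.contDiffOn_normSqAt (hG.contDiffOn_adjMomGS hK hY)
  have hTs : ContDiffOn ℝ ∞ (fun y ↦ normSqAt G y (symAt ((G y).comp (covDAt G Y y))
      + (2⁻¹ * divAt G Y y) • G y)) V :=
    hG.contDiffOn_normSqAt ((contDiffOn_symAt (hG.contDiffOn.clm_comp hA)).add
      ((contDiffOn_const.mul (hG.contDiffOn_divAt hY)).smul hG.contDiffOn))
  have hSs : ContDiffOn ℝ ∞ (fun y ↦ normSqAt G y (symAt ((G y).comp (covDAt G Y y)))) V :=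
    hG.contDiffOn_normSqAt (contDiffOn_symAt (hG.contDiffOn.clm_comp hA))
  have hnYs : ContDiffOn ℝ ∞ (fun y ↦ G y (Y y) (Y y)) V := (hG.contDiffOn.clm_apply hY).clm_apply hY
  have hLs : ContDiffOn ℝ ∞ (fun y ↦ lapAt G N y ^ 2) V := (hG.contDiffOn_lapAt hN).pow 2
  -- vanishing off `S`
  have hs0 : symAt (0 : E →L[ℝ] E →L[ℝ] ℝ) = 0 := by ext v w; simp [symAt_apply]
  have hn0' : ∀ z, normSqAt G z (0 : E →L[ℝ] E →L[ℝ] ℝ) = 0 := fun z ↦ by simp [normSqAt_eq_traceCLM]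
  have van : ∀ z ∉ S,
      mtrAt G z ((G z).bilinearComp (covDAt G Y z) (covDAt G Y z)) = 0 ∧
      normSqAt G z (hessAt G N z) = 0 ∧
      normSqAt G z (adjHamK G K N z + adjMomKS G Y z) = 0 ∧
      normSqAt G z (adjHamG G K N z + adjMomGS G K Y z) = 0 ∧
      normSqAt G z (adjMomGS G K Y z) = 0 ∧
      normSqAt G z (symAt ((G z).comp (covDAt G Y z)) + (2⁻¹ * divAt G Y z) • G z) = 0 ∧
      normSqAt G z (symAt ((G z).comp (covDAt G Y z))) = 0 ∧
      N z = 0 ∧ G z (Y z) (Y z) = 0 ∧ lapAt G N z = 0 := by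
    intro z hz
    obtain ⟨hNz, hYz⟩ := eventuallyEq_zero_of_notMem_union hz
    obtain ⟨hRK, hRG, hcov, hdiv, hhess, -, hN0, hY0⟩ :=
      kidRows_eq_zero_of_eventuallyEq (G := G) (K := K) hNz hYz
    have hM0 : adjMomGS G K Y z = 0 := by
      rw [adjMomGS_congr_of_eventuallyEq (EventuallyEq.rfl (f := G)) (EventuallyEq.rfl (f := K)) hYz]
      exact adjMomGS_zero_field
    have hlap : lapAt G N z = 0 := by
      rw [lapAt_congr_of_eventuallyEq G hNz]; exact lapAt_const G 0
    refine ⟨by rw [hcov, mtrAt_eq_sum b]; simp, by rw [hhess, hn0'], by rw [hRK, hn0'],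
      by rw [hRG, hn0'], by rw [hM0, hn0'], ?_, ?_, hN0, by simp [hY0], hlap⟩
    · rw [hcov, hdiv, ContinuousLinearMap.comp_zero, hs0, mul_zero, zero_smul, add_zero, hn0']
    · rw [hcov, ContinuousLinearMap.comp_zero, hs0, hn0']
  -- integrability
  have hInt : ∀ {k : E → ℝ}, ContDiffOn ℝ ∞ k V → (∀ z ∉ S, k z = 0) →
      Integrable (fun z ↦ sqrtDetGram G b z * k z) μ := fun hk hk0 ↦
    hG.integrable_sqrtDetGram_mul_of_subset b μ hpos hS hSc hSV hk hk0
  have IQ := hInt hQs fun z hz ↦ (van z hz).1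
  have IH := hInt hHs fun z hz ↦ (van z hz).2.1
  have IRK := hInt hRKs fun z hz ↦ (van z hz).2.2.1
  have IRG := hInt hRGs fun z hz ↦ (van z hz).2.2.2.1
  have IM := hInt hMs fun z hz ↦ (van z hz).2.2.2.2.1
  have IT := hInt hTs fun z hz ↦ (van z hz).2.2.2.2.2.1
  have IS := hInt hSs fun z hz ↦ (van z hz).2.2.2.2.2.2.1
  have IN := hInt (hN.pow 2) fun z hz ↦ by simp [(van z hz).2.2.2.2.2.2.2.1]
  have IY := hInt hnYs fun z hz ↦ (van z hz).2.2.2.2.2.2.2.2.1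
  have IL := hInt hLs fun z hz ↦ by simp [(van z hz).2.2.2.2.2.2.2.2.2]
  have I0 : Integrable (fun z ↦ sqrtDetGram G b z * (fun _ ↦ (0 : ℝ)) z) μ := by simp
  -- notation for the quantities
  set Qq := ∫ y, sqrtDetGram G b y * mtrAt G y ((G y).bilinearComp (covDAt G Y y) (covDAt G Y y)) ∂μ
  set H := ∫ y, sqrtDetGram G b y * normSqAt G y (hessAt G N y) ∂μ
  set D := ∫ y, sqrtDetGram G b y * gradSqAt G N y ∂μ
  set RK := ∫ y, sqrtDetGram G b y * normSqAt G y (adjHamK G K N y + adjMomKS G Y y) ∂μ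
  set RG := ∫ y, sqrtDetGram G b y * normSqAt G y (adjHamG G K N y + adjMomGS G K Y y) ∂μ
  set Nn := ∫ y, sqrtDetGram G b y * N y ^ 2 ∂μ
  set Yy := ∫ y, sqrtDetGram G b y * G y (Y y) (Y y) ∂μ
  set τ := ∫ y, sqrtDetGram G b y * normSqAt G y (symAt ((G y).comp (covDAt G Y y))
    + (2⁻¹ * divAt G Y y) • G y) ∂μ
  set Ss := ∫ y, sqrtDetGram G b y * normSqAt G y (symAt ((G y).comp (covDAt G Y y))) ∂μ
  set Mm := ∫ y, sqrtDetGram G b y * normSqAt G y (adjMomGS G K Y y) ∂μ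
  set L := ∫ y, sqrtDetGram G b y * lapAt G N y ^ 2 ∂μ
  -- (a) Korn with `u = 0`
  have ia : Qq ≤ 4 * Ss + 2 * ρ * Yy := by
    have h := hG.integral_weightedKornGradient b μ hpos (contDiffOn_const (c := (0 : ℝ))) hric hY hYs hYV
    have h0 : ∀ y, gradSqAt G (fun _ : E ↦ (0 : ℝ)) y = 0 := fun y ↦ by
      rw [gradSqAt_apply, fderiv_fun_const]; rfl
    simp only [mul_zero, Real.exp_zero, one_mul, h0, zero_add] at h
    have e : ∫ y, sqrtDetGram G b y * (ρ * G y (Y y) (Y y)) ∂μ = ρ * Yy := by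
      rw [← integral_const_mul]; exact integral_congr_ae (Eventually.of_forall fun y ↦ by ring)
    rw [e] at h
    linarith only [h]
  -- (b) `Ss ≤ sn τ`
  have ib : Ss ≤ sn * τ := by
    have h := integral_sqrtDetGram_le_of_pointwise₃ b μ S sn 0 0 IS IT I0 I0 (fun y hy ↦ ?_)
      (fun y hy ↦ ⟨(van y hy).2.2.2.2.2.2.1, (van y hy).2.2.2.2.2.1, rfl, rfl⟩)
    · simpa only [zero_mul, add_zero] using h
    · have := normSqAt_symAt_covDAt_le_kidT (Y := Y) hG (hSV hy) (hpos y (hSV hy))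
      simpa only [mul_zero, add_zero, ← hndef] using this
  -- (c) `τ ≤ cn RK + 3 w₁ Nn`
  have ic : τ ≤ cn * RK + 3 * w₁ * Nn := by
    have h := integral_sqrtDetGram_le_of_pointwise₃ b μ S cn (3 * w₁) 0 IT IRK IN I0 (fun y hy ↦ ?_)
      (fun y hy ↦ ⟨(van y hy).2.2.2.2.2.1, (van y hy).2.2.1, by simp [(van y hy).2.2.2.2.2.2.2.1], rfl⟩)
    · simpa only [zero_mul, add_zero] using h
    · have hyV := hSV hy
      have hpt := kidT_weighted_le (K := K) (N := N) (Y := Y) (e := (1 : ℝ)) (X := 1) (x₀ := 1)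
        hG hyV (hpos y hyV) hn zero_le_one (by norm_num) (by norm_num) (hWK y hyV)
      simp only [one_pow, one_mul, mul_one, mul_zero, add_zero] at hpt ⊢
      simpa only [← hndef] using hpt
  -- (d) `H ≤ an RG + 3 z₁ Nn + an Mm`
  have id' : H ≤ an * RG + 3 * z₁ * Nn + an * Mm := by
    have h := integral_sqrtDetGram_le_of_pointwise₃ b μ S an (3 * z₁) an IH IRG IN IM (fun y hy ↦ ?_)
      (fun y hy ↦ ⟨(van y hy).2.1, (van y hy).2.2.2.1, by simp [(van y hy).2.2.2.2.2.2.2.1],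
        (van y hy).2.2.2.2.1⟩)
    · exact h
    · have hyV := hSV hy
      have hpt := hessAt_weighted_le (K := K) (N := N) (Y := Y) (e := (1 : ℝ)) (X := 1) (x₀ := 1)
        hG hyV (hpos y hyV) hn zero_le_one (by norm_num) (by norm_num) (hZ y hyV)
      simp only [one_pow, one_mul, mul_one] at hpt
      simpa only [← hndef] using hpt
  -- (e) `Mm ≤ c1 k₁ Qq + c2 k₂ Yy`
  have ie : Mm ≤ c1 * k₁ * Qq + c2 * k₂ * Yy := by
    have h := integral_sqrtDetGram_le_of_pointwise₃ b μ S (c1 * k₁) (c2 * k₂) 0 IM IQ IY I0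
      (fun y hy ↦ ?_) (fun y hy ↦ ⟨(van y hy).2.2.2.2.1, (van y hy).1, (van y hy).2.2.2.2.2.2.2.2.1, rfl⟩)
    · simpa only [zero_mul, add_zero] using h
    · have hyV := hSV hy
      have hpt := adjMomGS_weighted_le b (e := (1 : ℝ)) (X := 1) (x₀ := 1) hG hyV (hpos y hyV) hK hKs hY
        zero_le_one (by norm_num) (by norm_num) (by norm_num) (hKn y hyV) (hcovK y hyV)
      simp only [one_pow, one_mul, mul_one, mul_zero, add_zero] at hpt ⊢
      simpa only [← hndef] using hpt
  -- (f) `D ≤ ½ Nn + ½ L`, `L ≤ n H`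
  have if₁ : D ≤ 2⁻¹ * Nn + 2⁻¹ * L := hG.integral_gradSq_le_half b μ hpos hN hNs hNV
  have if₂ : L ≤ n * H := by
    have h := integral_sqrtDetGram_le_of_pointwise₃ b μ S n 0 0 IL IH I0 I0 (fun y hy ↦ ?_)
      (fun y hy ↦ ⟨by simp [(van y hy).2.2.2.2.2.2.2.2.2], (van y hy).2.1, rfl, rfl⟩)
    · simpa only [zero_mul, add_zero] using h
    · have hyV := hSV hy
      have := mtrAt_sq_le_normSqAt hG hyV (hpos y hyV) (hessAt G N y)
      simp only [mul_zero, add_zero, lapAt]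
      exact this
  -- nonnegativity
  have nn : ∀ {k : E → ℝ}, (∀ y ∈ S, 0 ≤ k y) → (∀ y ∉ S, k y = 0) →
      0 ≤ ∫ y, sqrtDetGram G b y * k y ∂μ := by
    intro k hk hk0
    refine integral_nonneg fun y ↦ ?_
    show 0 ≤ sqrtDetGram G b y * k y
    by_cases hy : y ∈ S
    · exact mul_nonneg (Real.sqrt_nonneg _) (hk y hy)
    · rw [hk0 y hy, mul_zero]
  have hRK0 : 0 ≤ RK := nn (fun y hy ↦ normSqAt_nonneg_of_pos hG (hSV hy) (hpos y (hSV hy)) _)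
    fun y hy ↦ (van y hy).2.2.1
  have hRG0 : 0 ≤ RG := nn (fun y hy ↦ normSqAt_nonneg_of_pos hG (hSV hy) (hpos y (hSV hy)) _)
    fun y hy ↦ (van y hy).2.2.2.1
  have hNn0 : 0 ≤ Nn := nn (fun y _ ↦ sq_nonneg _) fun y hy ↦ by simp [(van y hy).2.2.2.2.2.2.2.1]
  have hYy0 : 0 ≤ Yy := nn (fun y hy ↦ by
      by_cases hz : Y y = 0
      · simp [hz]
      · exact (hpos y (hSV hy) _ hz).le) fun y hy ↦ (van y hy).2.2.2.2.2.2.2.2.1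
  -- combine
  have jQ : Qq ≤ CQ * (RK + RG + Nn + Yy) := by
    have a := mul_le_mul_of_nonneg_left ib (by norm_num : (0 : ℝ) ≤ 4)
    have a2 := mul_le_mul_of_nonneg_left ic (by positivity : 0 ≤ 4 * sn)
    have p1 : 0 ≤ 4 * sn * cn * (RG + Nn + Yy) := by positivity
    have p2 : 0 ≤ 12 * sn * w₁ * (RK + RG + Yy) := by positivity
    have p3 : 0 ≤ 2 * ρ * (RK + RG + Nn) := by positivity
    have e : CQ * (RK + RG + Nn + Yy) = 4 * sn * cn * RK + 12 * sn * w₁ * Nn + 2 * ρ * Yy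
        + (4 * sn * cn * (RG + Nn + Yy) + 12 * sn * w₁ * (RK + RG + Yy) + 2 * ρ * (RK + RG + Nn)) := by
      rw [hCQ]; ring
    rw [e]
    linarith only [ia, a, a2, p1, p2, p3]
  have jH : H ≤ CH * (RK + RG + Nn + Yy) := by
    have hsum0 : 0 ≤ RK + RG + Nn + Yy := by positivity
    have a1 := mul_le_mul_of_nonneg_left jQ (by positivity : 0 ≤ an * c1 * k₁)
    have a2 : an * Mm ≤ an * (c1 * k₁ * Qq + c2 * k₂ * Yy) := mul_le_mul_of_nonneg_left ie han0
    have p1 : 0 ≤ an * (RK + Nn + Yy) := by positivity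
    have p2 : 0 ≤ 3 * z₁ * (RK + RG + Yy) := by positivity
    have p3 : 0 ≤ an * c2 * k₂ * (RK + RG + Nn) := by positivity
    have e : CH * (RK + RG + Nn + Yy) = an * RG + 3 * z₁ * Nn + an * c1 * k₁ * (CQ * (RK + RG + Nn + Yy))
        + an * c2 * k₂ * Yy + (an * (RK + Nn + Yy) + 3 * z₁ * (RK + RG + Yy)
        + an * c2 * k₂ * (RK + RG + Nn)) := by rw [hCH]; ring
    rw [e]
    linarith only [id', a1, a2, p1, p2, p3]
  have jD : D ≤ ((n / 2) * CH + 2⁻¹) * (RK + RG + Nn + Yy) := by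
    have a1 := mul_le_mul_of_nonneg_left if₂ (by norm_num : (0 : ℝ) ≤ 2⁻¹)
    have a2 := mul_le_mul_of_nonneg_left jH (by positivity : 0 ≤ n / 2)
    have p1 : 0 ≤ 2⁻¹ * (RK + RG + Yy) := by positivity
    have e : ((n / 2) * CH + 2⁻¹) * (RK + RG + Nn + Yy) =
        n / 2 * (CH * (RK + RG + Nn + Yy)) + 2⁻¹ * Nn + 2⁻¹ * (RK + RG + Yy) := by ring
    rw [e]
    linarith only [if₁, a1, a2, p1]
  have e : (CQ + (1 + n / 2) * CH + 2⁻¹) * (RK + RG + Nn + Yy) =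
      CQ * (RK + RG + Nn + Yy) + CH * (RK + RG + Nn + Yy)
        + ((n / 2) * CH + 2⁻¹) * (RK + RG + Nn + Yy) := by ring
  rw [e]
  linarith only [jQ, jH, jD]

end MetricCoord

end Literature.Geometry.Lorentzian

end
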